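import Literature.Probability.RandomPlanarGeometry.HexSAWBrickWallStripFugacityLevel0Insertion
import Literature.Probability.RandomPlanarGeometry.HexSAWBrickWallStripMarginTheta
import HarnessLib

/-!
# BBdGDCG 2014 Proposition 7 (strict part) for the printed one-level surface: `μ_T(y,1) < μ_{T+1}(y,1)`, every `y > 0`

Topic `Literature/Probability/RandomPlanarGeometry` (the leaf of the one-level chain
`HexSAWBrickWallStripFugacityLevel0.lean` — `C_{T,n}(y,1) = HexBW.stripZ₀ T n y` with the fugacity on the SURFACE
vertices of the bottom boundary (row `0`, dangling vertical bond = Duminil-Copin–Smirnov level `0`),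
`μ_T(y,1) = HexBW.stripMuY₀ T y` — and `HexSAWBrickWallStripFugacityLevel0Insertion.lean` — the weighted finite core
`C_{T,n}(y,1) xⁿ (1 + θ x^{4T+8})^{⌊n/(2(T+1))⌋} ≤ Σ_{m ≤ (4T+9)n} C_{T+1,m}(y,1) x^m`, `θ = min 1 (y⁴)`; the analytic
extraction is `MarginExtraction.log_margin_of_core_theta` of `HexSAWBrickWallStripMarginTheta.lean`).  Source:
N. R. Beaton, M. Bousquet-Mélou, J. de Gier, H. Duminil-Copin, A. J. Guttmann, Comm. Math. Phys. 326 (2014),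
arXiv:1109.0358v5, Proposition 7 (p. 11): "For `y > 0`, we have `μ_T(1,y) < μ_{T+1}(1,y)`" — printed as "an adaptation
to the honeycomb lattice of results proved by van Rensburg, Orlandini and Whittington for the hypercubic lattices"
(proof pp. 11–12: unfolded arches, a prime arch spanning the strip, the factorisation `P̃_T/(1 − P̃_T)`) — for the
top-weighted constant `μ_T(1,y)`, which equals the bottom-weighted `μ_T(y,1)` by the bridge symmetry of Proposition 6
(p. 10).  THIS file proves the strict inequality for the lane's bottom-weighted one-level `μ_T(y,1)` (translation
classes of the brick-wall strip of `T + 1` rows; no numerical identification with the printed height; not rooted at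
a mid-edge — growth rates of the two normalisations agree by unfolding, not formalised) FOR EVERY `y > 0` by the
lane's four-column insertion (the surface weight changes by a factor in `[min(1,y)⁴, max(1,y)⁴]` per inserted slab)
and the `θ`-extraction lemma, with the explicit margin below — a proof different from both the printed arch
factorisation and Madras–Slade's irreducible-bridge renewal proof of Theorem 8.2.1 ((8.2.13), p. 269, proof p. 270;
`y = 1`, `ℤ^d`).  The
explicit margin is not in print.  The convergence `μ_T(1,y) → μ(y)` is not treated here.  (The two-level, whole-row
weighted variant is `HexSAWBrickWallStripFugacity*.lean`; at `y = 1` both are the tree's `μ(S_T)`,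
`HexBW.stripConnectiveConstant_lt_succ`.)

## Statements (namespace `Literature.Probability.RandomPlanarGeometry.SAW.HexBW`, all PROVED, standard axioms)

* **`log_stripMuY₀_succ_sub_log_ge (hy : 0 < y) (T)`** —
  `log(1 + min(1,y⁴) μ_{T+1}(y,1)^{-(4T+8)}) / (2(T+1)) ≤ log μ_{T+1}(y,1) − log μ_T(y,1)`;
* **`stripMuY₀_lt_succ (hy : 0 < y) (T)`** — `μ_T(y,1) < μ_{T+1}(y,1)` (Proposition 7, strict part, every `y > 0`);
  `strictMono_stripMuY₀`.
-/

noncomputable section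

open Filter Topology Finset Literature.Probability.LatticeModels Literature.Probability.Percolation

namespace Literature.Probability.RandomPlanarGeometry.SAW.HexBW

open MarginExtraction

/-- **Proposition 7 of BBdGDCG 2014, strict part, FOR EVERY `y > 0`, WITH MARGIN**, one-level surface:
`log(1 + min(1,y⁴) · μ_{T+1}(y,1)^{-(4T+8)}) / (2(T+1)) ≤ log μ_{T+1}(y,1) − log μ_T(y,1)` for the growth rates
`μ_T(y,1) = HexBW.stripMuY₀ T y` of the honeycomb strips.
[cite: BeatonBousquetMelouDeGierDuminilCopinGuttmann2014, Proposition 7 (arXiv v5 p. 11: μ_T(1,y) < μ_{T+1}(1,y)) with Proposition 6 (p. 10: μ_T(y,1) = μ_T(1,y)); printed without a rate — the explicit margin and the insertion proof are the lane's] -/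
theorem log_stripMuY₀_succ_sub_log_ge {y : ℝ} (hy : 0 < y) (T : ℕ) :
    Real.log (1 + min 1 (y ^ 4) * stripMuY₀ (T + 1) y ^ (-(4 * (T : ℝ) + 8))) / (2 * ((T : ℝ) + 1)) ≤
      Real.log (stripMuY₀ (T + 1) y) - Real.log (stripMuY₀ T y) := by
  have hK := one_le_yK y
  have hK0 : 0 < yK y := by linarith
  have hμpos := stripMuY₀_pos T hy
  have hθ0 : 0 ≤ min 1 (y ^ 4) := le_min zero_le_one (pow_nonneg hy.le 4)
  have hx := log_margin_of_core_theta (E := 4 * T + 8) (L := 2 * T + 1) (K := 4 * T + 9)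
    (C := fun m => stripZ₀ (T + 1) m y) (B := yK y) hμpos (one_le_stripMuY₀ (by omega) hy) hK0.le hθ0
    (fun m => (stripZ₀_pos (T + 1) m hy).le) (tendsto_stripZ₀_rpow (T + 1) hy)
    fun n x hx0 hx1 => by
      have e : n / (2 * T + 1 + 1) = n / (2 * (T + 1)) := by congr 1
      rw [e]
      have hpow := pow_stripMuY₀_le T n hy hμpos.le
      have hcore := weighted_core₀ T n hx0 hx1 hy
      have hb : 0 ≤ (1 + min 1 (y ^ 4) * x ^ (4 * T + 8)) ^ (n / (2 * (T + 1))) :=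
        pow_nonneg (by nlinarith [pow_nonneg hx0.le (4 * T + 8)]) _
      calc stripMuY₀ T y ^ n * x ^ n * (1 + min 1 (y ^ 4) * x ^ (4 * T + 8)) ^ (n / (2 * (T + 1)))
          ≤ (yK y * stripZ₀ T n y) * x ^ n * (1 + min 1 (y ^ 4) * x ^ (4 * T + 8)) ^ (n / (2 * (T + 1))) :=
            mul_le_mul_of_nonneg_right (mul_le_mul_of_nonneg_right hpow (pow_nonneg hx0.le n)) hb
        _ = yK y * (stripZ₀ T n y * x ^ n * (1 + min 1 (y ^ 4) * x ^ (4 * T + 8)) ^ (n / (2 * (T + 1)))) := by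
            ring
        _ ≤ yK y * ∑ m ∈ Finset.range ((4 * T + 9) * n + 1), stripZ₀ (T + 1) m y * x ^ m :=
            mul_le_mul_of_nonneg_left hcore hK0.le
  have e1 : ((4 * T + 8 : ℕ) : ℝ) = 4 * (T : ℝ) + 8 := by push_cast; ring
  have e2 : ((2 * T + 1 : ℕ) : ℝ) + 1 = 2 * ((T : ℝ) + 1) := by push_cast; ring
  rwa [e1, e2] at hx

/-- **Proposition 7 of BBdGDCG 2014 (strict part) for every `y > 0`, one-level surface**: `μ_T(y,1) < μ_{T+1}(y,1)`
— the growth rate of the honeycomb strip partition functions with fugacity `y` on the SURFACE vertices of the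
bottom boundary is strictly increasing in the width.
[cite: BeatonBousquetMelouDeGierDuminilCopinGuttmann2014, Proposition 7 (arXiv v5 p. 11: "For y > 0, we have μ_T(1,y) < μ_{T+1}(1,y)") with Proposition 6 (p. 10: μ_T(y,1) = μ_T(1,y)); there via unfolded-arch factorisation, not the proof formalised]
[cite: MadrasSlade1993, Theorem 8.2.1, (8.2.13) (p. 269) — y = 1, ℤ^d] -/
theorem stripMuY₀_lt_succ {y : ℝ} (hy : 0 < y) (T : ℕ) : stripMuY₀ T y < stripMuY₀ (T + 1) y := by
  have hm := log_stripMuY₀_succ_sub_log_ge hy T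
  have hμ := stripMuY₀_pos (T + 1) hy
  have hθ : 0 < min 1 (y ^ 4) := lt_min one_pos (pow_pos hy 4)
  have hprod : 0 < min 1 (y ^ 4) * stripMuY₀ (T + 1) y ^ (-(4 * (T : ℝ) + 8)) :=
    mul_pos hθ (Real.rpow_pos_of_pos hμ _)
  have hpos : 0 < Real.log (1 + min 1 (y ^ 4) * stripMuY₀ (T + 1) y ^ (-(4 * (T : ℝ) + 8))) /
      (2 * ((T : ℝ) + 1)) :=
    div_pos (Real.log_pos (by linarith)) (by positivity)
  have : Real.log (stripMuY₀ T y) < Real.log (stripMuY₀ (T + 1) y) := by linarith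
  exact (Real.log_lt_log_iff (stripMuY₀_pos T hy) hμ).1 this

/-- `T ↦ μ_T(y,1)` is strictly increasing for every `y > 0`. [cite: BeatonBousquetMelouDeGierDuminilCopinGuttmann2014, Proposition 7 (arXiv v5 p. 11)] -/
theorem strictMono_stripMuY₀ {y : ℝ} (hy : 0 < y) : StrictMono fun T => stripMuY₀ T y :=
  strictMono_nat_of_lt_succ fun T => stripMuY₀_lt_succ hy T

end Literature.Probability.RandomPlanarGeometry.SAW.HexBW
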